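import Summits.AtomisticToContinuum.FouriersLaw.Theorems.BoundaryEscapeDeficitHalfChainLocalityPeeling

/-!
# The boundary-window marginals of the finite-chain Gibbs measures in transfer-operator form

Helper file (`--supports stmt-AtomisticToContinuum-12240`, item `HalfChainLocality` of route
`BoundaryEscapeDeficit`, sub-problem `FouriersLaw`). Notation as in `…HalfChainLocalityPeeling`:
`W_N = e^{-H_N/T}` on `PhaseSpace N`, one-site a priori measure `ρ = e^{-(p²/2+U(q))/T} dq dp` on
`ℝ × ℝ`, lintegral transfer step `(κ g)(z) = ∫ e^{-V(z'.1 - z.1)/T} g(z') dρ(z')`, and the window map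
`take_{ℓ+1} : PhaseSpace (n+1) → PhaseSpace (ℓ+1)` (restriction to the first `ℓ+1` sites, `Fin.take`).

* `map_take_withDensity_gibbsWeight` — `(W_{n+1}·Leb) ∘ take_{ℓ+1}⁻¹ = (W_{ℓ+1}·Leb)` with the extra
  density `(κ^[n-ℓ] 1)(y_ℓ)` (a function of the LAST window site only);
* `partitionFunction_succ_eq_lintegral_transferIterate` — `Z_{n+1} = ∫ κ^[n] 1 dρ`;
* `transferIterate_one_eq_ofReal` — the bridge to the REAL (Bochner) transfer operator
  `(κ_ℝ f)(z) = ∫ e^{-V(z'.1-z.1)/T} f(z') dρ(z')` of `Literature.Analysis.OperatorTheory`: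
  `κ^[m] 1 = ofReal ∘ κ_ℝ^[m] 1`, with `0 ≤ κ_ℝ^[m] 1 ≤ (ρ(ℝ²))^m`;
* `gibbsMeasure_map_take` (**main**) — for the normalised Gibbs measures (`e^{-H_N/T}` integrable for
  all `N`): `μ_{n+1} ∘ take_{ℓ+1}⁻¹ = μ_{ℓ+1}.withDensity (D_{n,ℓ}(y_ℓ))`,
  `D_{n,ℓ} = Z_{ℓ+1} Z_{n+1}⁻¹ κ^[n-ℓ] 1`.

All folklore (transfer-operator form of one-dimensional Gibbs marginals, Georgii 2011 §11.1); no
definitions.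
-/

noncomputable section

open MeasureTheory Set Function
open scoped ENNReal

namespace Summit.AtomisticToContinuum.FouriersLaw.Theorems.HalfChainLocality

open Literature.MathematicalPhysics.KineticTheory.HeatConduction

variable (P : OscillatorChain) (hU : Measurable P.U) (hV : Measurable P.V) (T : ℝ)

set_option quotPrecheck false

/-- The one-site a priori measure `ρ = e^{-(p²/2 + U(q))/T} dq dp` on `ℝ × ℝ`. -/
local notation "ρT" => (volume.withDensity fun z : ℝ × ℝ =>
  ENNReal.ofReal (Real.exp (-(z.2 ^ 2 / 2 + P.U z.1) / T)) : Measure (ℝ × ℝ))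

/-- The lintegral transfer step `(κ g)(z) = ∫ e^{-V(z'.1 - z.1)/T} g(z') dρ(z')`. -/
local notation "κT" => (fun g : ℝ × ℝ → ℝ≥0∞ => fun z : ℝ × ℝ =>
  ∫⁻ z', ENNReal.ofReal (Real.exp (-P.V (z'.1 - z.1) / T)) * g z' ∂ρT)

/-- The real (Bochner) transfer step `(κ_ℝ f)(z) = ∫ e^{-V(z'.1 - z.1)/T} f(z') dρ(z')`. -/
local notation "κR" => (fun f : ℝ × ℝ → ℝ => fun z : ℝ × ℝ =>
  ∫ z', Real.exp (-P.V (z'.1 - z.1) / T) * f z' ∂ρT)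

/-! ### The window map -/

/-- The window (restriction) map `take_{m} : PhaseSpace N → PhaseSpace m` is measurable. [folklore] -/
theorem measurable_take (m N : ℕ) (h : m ≤ N) :
    Measurable fun x : PhaseSpace N => ((Fin.take m h x.1 : Fin m → ℝ), (Fin.take m h x.2 : Fin m → ℝ)) :=
  (measurable_pi_lambda _ fun _ => (measurable_pi_apply _).comp measurable_fst).prodMk
    (measurable_pi_lambda _ fun _ => (measurable_pi_apply _).comp measurable_snd)

/-- The last-site map `y ↦ (q_ℓ, p_ℓ) : PhaseSpace (ℓ+1) → ℝ × ℝ` is measurable. [folklore] -/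
theorem measurable_lastSite (ℓ : ℕ) :
    Measurable fun y : PhaseSpace (ℓ + 1) => (y.1 (Fin.last ℓ), y.2 (Fin.last ℓ)) :=
  ((measurable_pi_apply _).comp measurable_fst).prodMk ((measurable_pi_apply _).comp measurable_snd)

/-! ### The window marginal of the Gibbs WEIGHT -/

include hU hV in
/-- **Window marginal of the Gibbs weight.** For `ℓ ≤ n`, the image of `e^{-H_{n+1}/T} dx` under the
restriction to the first `ℓ+1` sites is `e^{-H_{ℓ+1}/T} dy` with the extra density
`(κ^[n-ℓ] 1)(q_ℓ, p_ℓ)`. [folklore] -/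
theorem map_take_withDensity_gibbsWeight (n ℓ : ℕ) (hℓ : ℓ ≤ n) :
    (volume.withDensity fun x : PhaseSpace (n + 1) => ENNReal.ofReal (P.gibbsDensity (n + 1) T x)).map
        (fun x : PhaseSpace (n + 1) =>
          ((Fin.take (ℓ + 1) (Nat.succ_le_succ hℓ) x.1 : Fin (ℓ + 1) → ℝ),
            (Fin.take (ℓ + 1) (Nat.succ_le_succ hℓ) x.2 : Fin (ℓ + 1) → ℝ))) =
      (volume.withDensity fun y : PhaseSpace (ℓ + 1) => ENNReal.ofReal (P.gibbsDensity (ℓ + 1) T y)).withDensity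
        fun y => (κT^[n - ℓ] 1) (y.1 (Fin.last ℓ), y.2 (Fin.last ℓ)) := by
  have hτ := measurable_take (ℓ + 1) (n + 1) (Nat.succ_le_succ hℓ)
  have hG : Measurable fun y : PhaseSpace (ℓ + 1) => (κT^[n - ℓ] 1) (y.1 (Fin.last ℓ), y.2 (Fin.last ℓ)) :=
    (measurable_transferStep_iterate P hV T measurable_one (n - ℓ)).comp (measurable_lastSite ℓ)
  refine Measure.ext fun A hA => ?_
  rw [Measure.map_apply hτ hA, withDensity_apply _ (hτ hA), withDensity_apply _ hA,
    ← lintegral_indicator (hτ hA), ← lintegral_indicator hA,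
    lintegral_withDensity_eq_lintegral_mul _ (measurable_ofReal_gibbsDensity P hU hV T (ℓ + 1))
      (hG.indicator hA)]
  have key := lintegral_take_mul_last_mul_gibbsWeight P hU hV T n ℓ hℓ (measurable_one.indicator hA)
    (h := 1) measurable_one
  -- rewrite both sides into the shape of the peeling identity
  have hL : ∀ x : PhaseSpace (n + 1),
      ((fun x : PhaseSpace (n + 1) => ((Fin.take (ℓ + 1) (Nat.succ_le_succ hℓ) x.1 : Fin (ℓ + 1) → ℝ),
        (Fin.take (ℓ + 1) (Nat.succ_le_succ hℓ) x.2 : Fin (ℓ + 1) → ℝ))) ⁻¹' A).indicator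
        (fun x => ENNReal.ofReal (P.gibbsDensity (n + 1) T x)) x =
      (A.indicator (1 : PhaseSpace (ℓ + 1) → ℝ≥0∞))
          ((Fin.take (ℓ + 1) (Nat.succ_le_succ hℓ) x.1 : Fin (ℓ + 1) → ℝ),
            (Fin.take (ℓ + 1) (Nat.succ_le_succ hℓ) x.2 : Fin (ℓ + 1) → ℝ)) *
        (1 : ℝ × ℝ → ℝ≥0∞) (x.1 (Fin.last n), x.2 (Fin.last n)) *
          ENNReal.ofReal (P.gibbsDensity (n + 1) T x) := by
    intro x
    by_cases hx : (((Fin.take (ℓ + 1) (Nat.succ_le_succ hℓ) x.1 : Fin (ℓ + 1) → ℝ),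
        (Fin.take (ℓ + 1) (Nat.succ_le_succ hℓ) x.2 : Fin (ℓ + 1) → ℝ)) : PhaseSpace (ℓ + 1)) ∈ A
    · simp only [Set.indicator, Set.mem_preimage, hx, if_true, Pi.one_apply, one_mul]
    · simp only [Set.indicator, Set.mem_preimage, hx, if_false, zero_mul]
  have hR : ∀ y : PhaseSpace (ℓ + 1),
      ((fun y : PhaseSpace (ℓ + 1) => ENNReal.ofReal (P.gibbsDensity (ℓ + 1) T y)) *
          A.indicator (fun y => (κT^[n - ℓ] 1) (y.1 (Fin.last ℓ), y.2 (Fin.last ℓ)))) y =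
      (A.indicator (1 : PhaseSpace (ℓ + 1) → ℝ≥0∞)) y *
        (κT^[n - ℓ] 1) (y.1 (Fin.last ℓ), y.2 (Fin.last ℓ)) *
          ENNReal.ofReal (P.gibbsDensity (ℓ + 1) T y) := by
    intro y
    rw [Pi.mul_apply]
    by_cases hy : y ∈ A
    · rw [Set.indicator_of_mem hy, Set.indicator_of_mem hy, Pi.one_apply, one_mul, mul_comm]
    · rw [Set.indicator_of_notMem hy, Set.indicator_of_notMem hy]
      simp
  simp_rw [hL, hR]
  exact key

/-! ### The partition function -/

omit hU hV in
/-- Lebesgue measure of the (one-point) phase space of the empty chain is `1`. [folklore] -/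
theorem volume_phaseSpace_zero_univ : (volume : Measure (PhaseSpace 0)) univ = 1 := by
  have h1 : (volume : Measure (Fin 0 → ℝ)) univ = 1 := by
    rw [volume_pi, Measure.pi_univ]
    simp
  rw [show (volume : Measure (PhaseSpace 0)) = (volume : Measure (Fin 0 → ℝ)).prod volume from rfl,
    ← univ_prod_univ, Measure.prod_prod, h1, one_mul]

omit hU hV in
/-- Integrals over the one-site phase space `PhaseSpace 1` of functions of the single site are
integrals over `ℝ × ℝ`. [folklore] -/
theorem lintegral_phaseSpace_one {g : ℝ × ℝ → ℝ≥0∞} (hg : Measurable g) :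
    ∫⁻ y : PhaseSpace 1, g (y.1 (Fin.last 0), y.2 (Fin.last 0)) = ∫⁻ z, g z := by
  rw [lintegral_phaseSpace_succ 0 (F := fun y : PhaseSpace 1 => g (y.1 (Fin.last 0), y.2 (Fin.last 0)))
    (hg.comp (measurable_lastSite 0))]
  simp only [Fin.snoc_last, Prod.mk.eta]
  rw [lintegral_const, volume_phaseSpace_zero_univ, mul_one]

include hU hV in
/-- **The partition function in transfer-operator form**: `Z_{n+1} = ∫ (κ^[n] 1) dρ`. [folklore] -/
theorem partitionFunction_succ_eq_lintegral_transferIterate (n : ℕ) :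
    P.partitionFunction (n + 1) T = ∫⁻ z, (κT^[n] 1) z ∂ρT := by
  unfold OscillatorChain.partitionFunction
  have key := lintegral_take_mul_last_mul_gibbsWeight P hU hV T n 0 (Nat.zero_le n) (F := fun _ => 1)
    measurable_const (h := 1) measurable_one
  simp only [one_mul, Pi.one_apply, Nat.sub_zero] at key
  have key' : ∫⁻ x : PhaseSpace (n + 1), ENNReal.ofReal (P.gibbsDensity (n + 1) T x) =
      ∫⁻ y : PhaseSpace 1, (κT^[n] 1) (y.1 (Fin.last 0), y.2 (Fin.last 0)) *
        ENNReal.ofReal (P.gibbsDensity 1 T y) := key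
  rw [key']
  have hG : Measurable (κT^[n] 1) := measurable_transferStep_iterate P hV T measurable_one n
  have h1 : ∀ y : PhaseSpace 1, ENNReal.ofReal (P.gibbsDensity 1 T y) =
      ENNReal.ofReal (Real.exp (-((y.2 (Fin.last 0)) ^ 2 / 2 + P.U (y.1 (Fin.last 0))) / T)) := by
    intro y
    simp only [OscillatorChain.gibbsDensity, Literature.Barriers.AtomisticToContinuum.HeatConduction.hamiltonian_one]
    rfl
  simp_rw [h1]
  rw [lintegral_phaseSpace_one (g := fun z : ℝ × ℝ => (κT^[n] 1) z *
      ENNReal.ofReal (Real.exp (-(z.2 ^ 2 / 2 + P.U z.1) / T))) (hG.mul (measurable_siteWeight P hU T)),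
    lintegral_siteMeasure_eq P hU T hG]

/-! ### Bridge to the real transfer operator -/

section Real

omit hU hV in
/-- The bond Boltzmann factor lies in `(0, 1]` (`V ≥ 0`, `T ≥ 0`). [folklore] -/
theorem bondFactor_pos_le_one (hV0 : ∀ r, 0 ≤ P.V r) (hT : 0 ≤ T) (a : ℝ) :
    0 < Real.exp (-P.V a / T) ∧ Real.exp (-P.V a / T) ≤ 1 :=
  ⟨Real.exp_pos _, Real.exp_le_one_iff.2 (div_nonpos_of_nonpos_of_nonneg (neg_nonpos.2 (hV0 a)) hT)⟩

omit hU hV in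
/-- **`κ^[m] 1 = ofReal ∘ κ_ℝ^[m] 1` with `0 ≤ κ_ℝ^[m] 1 ≤ ρ(ℝ²)^m`**: on the constant `1` the lintegral
transfer iterates are the (everywhere finite, nonnegative, bounded) real transfer iterates, and the
latter are measurable. [folklore] -/
theorem transferIterate_one_eq_ofReal (hVc : Continuous P.V) (hV0 : ∀ r, 0 ≤ P.V r) (hT : 0 ≤ T)
    (hfin : IsFiniteMeasure ρT) (m : ℕ) :
    (∀ z, (κT^[m] 1) z = ENNReal.ofReal ((κR^[m] 1) z)) ∧
      (∀ z, 0 ≤ (κR^[m] 1) z ∧ (κR^[m] 1) z ≤ ((ρT).real univ) ^ m) ∧ Measurable (κR^[m] 1) := by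
  induction m with
  | zero =>
    refine ⟨fun z => by simp, fun z => by simp, ?_⟩
    simp only [Function.iterate_zero, id_eq]
    exact measurable_const
  | succ m ih =>
    obtain ⟨ih1, ih2, ih3⟩ := ih
    have hk : ∀ z : ℝ × ℝ, Measurable fun z' : ℝ × ℝ => Real.exp (-P.V (z'.1 - z.1) / T) := fun z =>
      ((hVc.measurable.comp (measurable_fst.sub measurable_const)).neg.div_const T).exp
    -- integrability of the real integrand
    have hint : ∀ z : ℝ × ℝ, Integrable (fun z' => Real.exp (-P.V (z'.1 - z.1) / T) * (κR^[m] 1) z') ρT := by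
      intro z
      refine Integrable.mono' (integrable_const (((ρT).real univ) ^ m))
        ((hk z).mul ih3).aestronglyMeasurable (Filter.Eventually.of_forall fun z' => ?_)
      rw [Real.norm_eq_abs, abs_mul, abs_of_pos (bondFactor_pos_le_one P T hV0 hT _).1,
        abs_of_nonneg (ih2 z').1]
      calc Real.exp (-P.V (z'.1 - z.1) / T) * (κR^[m] 1) z' ≤ 1 * ((ρT).real univ) ^ m :=
            mul_le_mul (bondFactor_pos_le_one P T hV0 hT _).2 (ih2 z').2 (ih2 z').1 zero_le_one
        _ = ((ρT).real univ) ^ m := one_mul _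
    have hnn : ∀ z : ℝ × ℝ, 0 ≤ᵐ[ρT] fun z' => Real.exp (-P.V (z'.1 - z.1) / T) * (κR^[m] 1) z' := fun z =>
      Filter.Eventually.of_forall fun z' => mul_nonneg (Real.exp_nonneg _) (ih2 z').1
    refine ⟨fun z => ?_, fun z => ⟨?_, ?_⟩, ?_⟩
    · rw [Function.iterate_succ_apply', Function.iterate_succ_apply',
        ofReal_integral_eq_lintegral_ofReal (hint z) (hnn z)]
      refine lintegral_congr fun z' => ?_
      rw [ih1 z', ENNReal.ofReal_mul (Real.exp_nonneg _)]
    · rw [Function.iterate_succ_apply']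
      exact integral_nonneg_of_ae (hnn z)
    · rw [Function.iterate_succ_apply']
      calc ∫ z', Real.exp (-P.V (z'.1 - z.1) / T) * (κR^[m] 1) z' ∂ρT
          ≤ ∫ _z', ((ρT).real univ) ^ m ∂ρT := by
            refine integral_mono_of_nonneg (hnn z) (integrable_const _)
              (Filter.Eventually.of_forall fun z' => ?_)
            calc Real.exp (-P.V (z'.1 - z.1) / T) * (κR^[m] 1) z' ≤ 1 * ((ρT).real univ) ^ m :=
                  mul_le_mul (bondFactor_pos_le_one P T hV0 hT _).2 (ih2 z').2 (ih2 z').1 zero_le_one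
              _ = ((ρT).real univ) ^ m := one_mul _
        _ = ((ρT).real univ) ^ (m + 1) := by
            rw [integral_const, smul_eq_mul, pow_succ, mul_comm]
    · rw [Function.iterate_succ']
      have hK : Measurable fun v : (ℝ × ℝ) × (ℝ × ℝ) => Real.exp (-P.V (v.2.1 - v.1.1) / T) :=
        ((hVc.measurable.comp (measurable_snd.fst.sub measurable_fst.fst)).neg.div_const T).exp
      exact ((hK.mul (ih3.comp measurable_snd)).stronglyMeasurable.integral_prod_right').measurable

end Real

/-! ### The window marginal of the normalised Gibbs measure -/

include hU hV in
/-- **Window marginal of the Gibbs measure (transfer-operator form).** If `e^{-H_N/T}` is Lebesgue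
integrable for `N = ℓ+1, n+1` and continuous (so that `0 < Z < ∞`), then for `ℓ ≤ n` the law of the
first `ℓ+1` sites under the Gibbs measure of the `(n+1)`-chain is the Gibbs measure of the
`(ℓ+1)`-chain with the density `D_{n,ℓ}(q_ℓ, p_ℓ) = Z_{ℓ+1} Z_{n+1}⁻¹ (κ^[n-ℓ] 1)(q_ℓ, p_ℓ)` (a
function of the LAST window site only). [folklore] -/
theorem gibbsMeasure_map_take (n ℓ : ℕ) (hℓ : ℓ ≤ n)
    (hint_n : Integrable (P.gibbsDensity (n + 1) T)) (hint_ℓ : Integrable (P.gibbsDensity (ℓ + 1) T))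
    (hcont_ℓ : Continuous (P.gibbsDensity (ℓ + 1) T)) :
    (P.gibbsMeasure (n + 1) T).map
        (fun x : PhaseSpace (n + 1) =>
          ((Fin.take (ℓ + 1) (Nat.succ_le_succ hℓ) x.1 : Fin (ℓ + 1) → ℝ),
            (Fin.take (ℓ + 1) (Nat.succ_le_succ hℓ) x.2 : Fin (ℓ + 1) → ℝ))) =
      (P.gibbsMeasure (ℓ + 1) T).withDensity fun y =>
        P.partitionFunction (ℓ + 1) T * (P.partitionFunction (n + 1) T)⁻¹ *
          (κT^[n - ℓ] 1) (y.1 (Fin.last ℓ), y.2 (Fin.last ℓ)) := by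
  have hG : Measurable fun y : PhaseSpace (ℓ + 1) => (κT^[n - ℓ] 1) (y.1 (Fin.last ℓ), y.2 (Fin.last ℓ)) :=
    (measurable_transferStep_iterate P hV T measurable_one (n - ℓ)).comp (measurable_lastSite ℓ)
  have hZℓ0 : P.partitionFunction (ℓ + 1) T ≠ 0 := P.partitionFunction_ne_zero hcont_ℓ
  have hZℓt : P.partitionFunction (ℓ + 1) T ≠ ⊤ := P.partitionFunction_ne_top hint_ℓ
  rw [P.gibbsMeasure_eq_smul_withDensity hint_n, P.gibbsMeasure_eq_smul_withDensity hint_ℓ,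
    Measure.map_smul, map_take_withDensity_gibbsWeight P hU hV T n ℓ hℓ, withDensity_smul_measure]
  have e : (fun y : PhaseSpace (ℓ + 1) => P.partitionFunction (ℓ + 1) T * (P.partitionFunction (n + 1) T)⁻¹ *
        (κT^[n - ℓ] 1) (y.1 (Fin.last ℓ), y.2 (Fin.last ℓ))) =
      (P.partitionFunction (ℓ + 1) T * (P.partitionFunction (n + 1) T)⁻¹) •
        fun y : PhaseSpace (ℓ + 1) => (κT^[n - ℓ] 1) (y.1 (Fin.last ℓ), y.2 (Fin.last ℓ)) := by
    funext y
    simp only [Pi.smul_apply, smul_eq_mul]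
  rw [e, withDensity_smul _ hG, smul_smul, ← mul_assoc, ENNReal.inv_mul_cancel hZℓ0 hZℓt, one_mul]

end Summit.AtomisticToContinuum.FouriersLaw.Theorems.HalfChainLocality

end
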